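import Literature.Topology.FourManifolds.TubeFlowGeometry
import Literature.Topology.FourManifolds.FlowTimeChange
import Literature.Topology.FourManifolds.TrisectionsMiddleRegion
import HarnessLib

/-!
# The link condition of the trisection: the stable set of an index-`2` critical point meets the
# level below it in the attaching circle (Milnor 1965, Thm. 3.13; Gay–Kirby 2016, Lemma 14)

Topic `Literature/Topology/FourManifolds`; glue step for the fact seat
`provefact-Literature.Topology.FourManifolds.exists_isBalancedGKTrisection` (Gay–Kirby 2016,
Thm. 4 via §4, Lemma 14).  Everything in this file is **proved**; no definitions, no named facts.

The assembly of the trisection from a balanced handle decomposition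
(`TrisectionsInstantiation.lean`, `BiCollar.exists_isBalancedGKTrisection_of_handles`) has the
**link condition** as a hypothesis: *every point of the Heegaard level `Y = f⁻¹(a)` flowing
into a critical point `q` with `a < f q ≤ c` lies in `{g < b - η}`* — Gay–Kirby's first
hypothesis of Lemma 14, "the attaching link `L` of the `2`-handles lies in the interior of
`H₁₂`".  This file reduces it to a statement about the values of `g` on the **attaching circles
read in Milnor charts**:

* `MilnorBox.coord_of_mem_stableSet_of_apply_eq` — for a gradient-like field `ζ` of a Morse
  function on a closed `4`-manifold and a Milnor box `D` about the critical point `c` (Milnor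
  1965, Def. 3.1: `f = f c - |x⃗|² + |y⃗|²`, `ζ = (-x⃗, y⃗)` on the chart domain), **a point of
  the level `f = f c - η`, `0 < η < ε_D²`, on a trajectory going to `c` lies in the chart domain
  with `y⃗ = 0` and `|x⃗|² = η`** — it is a point of the left-hand sphere
  `{y⃗ = 0, |x⃗|² = η}` (Milnor 1965, Thm. 3.13 / proof of Thm. 3.12: the trajectory is
  eventually on the stable disc `y⃗ = 0` of the box, `MilnorBoxDynamics.lean`; followed
  backwards it stays on the disc down to the level, `TubeFlowGeometry.lean`; and a non-constant
  trajectory meets a level once);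
* `BiCollar.MorseFrame.linkCondition_of_milnorBoxes` — for bi-collar data whose unit field is a
  positive multiple `ρ • ζ` of such a `ζ` (the stable sets of `ρ • ζ` are those of `ζ`,
  `FlowTimeChange.lean`), Milnor boxes `D j` about the critical points `c_j` of `f` in
  `a < f ≤ c` reaching below the level `a` (`f c_j - a < ε_j²`), and a Heegaard function `g`
  with `g < b - η` at the points of `Y` read in some chart `j` with `y⃗ = 0`, the link
  condition holds.

## References

* J. Milnor, *Lectures on the h-cobordism theorem* (1965), Def. 3.1, Def. 3.9, proof of
  Thm. 3.12 and Thm. 3.13 (PDF pp. 16–19). [MilnorHCobordism1965]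
* D. Gay, R. Kirby, *Trisecting 4-manifolds*, Geom. Topol. 20 (2016), §4, Lemma 14 (first
  hypothesis) and proof of Thm. 4. [GayKirby2016]
-/

open scoped Manifold ContDiff Topology
open Set Function Filter

noncomputable section

universe u

namespace Literature.Topology.FourManifolds

open Flow

variable {X : Type u} [TopologicalSpace X] [T2Space X] [CompactSpace X]
  [ChartedSpace (EuclideanSpace ℝ (Fin 4)) X] [IsManifold (𝓡 4) ∞ X]

/-! ### The stable set meets the level below the critical point in the attaching sphere -/

/-- **A point of the level `f = f c - η` on a trajectory going to `c` is a point of the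
left-hand sphere of the Milnor box** (`0 < η < ε_D²`): it lies in the chart domain with
`|y⃗|² = 0` and `|x⃗|² = η`.  (The trajectory is eventually in the box on the stable disc
`y⃗ = 0` — otherwise `|y⃗|²` would grow like `e^{2t}` —; from such a point it runs backwards on
the disc, inside the closed box, down to the level `f c - η < f c - 0`, which it reaches before
the face `|x⃗|² = ε²` since `η < ε²`; along a non-constant trajectory of a gradient-like field
`f` is strictly increasing, so that level point is the given one.)
[cite: MilnorHCobordism1965, Def. 3.9 (PDF p. 16), proof of Thm. 3.12 and Thm. 3.13 (PDF pp. 18–19)] -/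
theorem MilnorBox.coord_of_mem_stableSet_of_apply_eq {f : X → ℝ}
    {ζ : Π x : X, TangentSpace (𝓡 4) x} {c : X}
    (hζ : ContMDiff (𝓡 4) (𝓡 4).tangent ∞ fun x => (⟨x, ζ x⟩ : TangentBundle (𝓡 4) X))
    (hgl : IsGradientLike (𝓡 4) f ζ) (hfM : IsMorse (𝓡 4) f) (D : MilnorBox (𝓡 4) f ζ c)
    {η : ℝ} (hη : 0 < η) (hηε : η < D.ε ^ 2) {y : X} (hy : y ∈ stableSet (𝓡 4) ζ c)
    (hfy : f y = f c - η) :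
    y ∈ D.chart.source ∧ sqSumGE D.k (D.coord y) = 0 ∧ sqSumLT D.k (D.coord y) = η := by
  set θ : ℝ × X → X := fun p => flow hζ p.2 p.1 with hθ
  have hflow : IsFlowOf (𝓡 4) ζ θ := (isSmoothFlow_flow hζ).isFlowOf
  have hlim : Tendsto (fun t => θ (t, y)) atTop (𝓝 c) := by
    have h := hy
    rw [stableSet_eq_setOf_tendsto hζ] at h
    exact h
  have hfc : Continuous f := hfM.contMDiff.continuous
  -- `y` is not critical: a critical point is fixed by the flow, and `f y ≠ f c`
  have hyc : ¬ IsMCriticalPt (𝓡 4) f y := fun h => by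
    have hfix : ∀ t, flow hζ y t = y := fun t =>
      flow_eq_self_of_apply_eq_zero hζ (hgl.apply_eq_zero_of_isMCriticalPt h) t
    have hconst : Tendsto (fun _ : ℝ => y) atTop (𝓝 c) := hlim.congr fun t => hfix t
    have hyc' : y = c := tendsto_nhds_unique tendsto_const_nhds hconst
    rw [hyc'] at hfy
    linarith
  have hmono : StrictMono (f ∘ flow hζ y) := hgl.strictMono_comp_flow hfM hζ hyc
  have hle_c : ∀ t, f (flow hζ y t) ≤ f c := fun t =>
    hmono.monotone.ge_of_tendsto ((hfc.tendsto c).comp hlim) t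
  -- eventually on the stable disc of the box; move to a nonnegative time `T₁`
  obtain ⟨T₀, hT₀box, hT₀B⟩ := D.exists_mem_box_sqSumGE_eq_zero_of_tendsto hflow hlim
  set T₁ : ℝ := max T₀ 0 with hT₁
  obtain ⟨hT₁box, hT₁B, -⟩ := D.forall_mem_box_of_sqSumGE_eq_zero hflow hT₀box hT₀B (T₁ - T₀)
    (sub_nonneg.2 (le_max_left _ _))
  have hgrp : θ (T₁ - T₀, θ (T₀, y)) = θ (T₁, y) := by
    rw [hflow.map_add]; congr 1; ring
  rw [hgrp] at hT₁box hT₁B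
  have hz_src : θ (T₁, y) ∈ D.chart.source := hT₁box.1
  have hfz_lt : f (θ (T₁, y)) < f c := by
    have h1 : f (flow hζ y T₁) < f (flow hζ y (T₁ + 1)) := hmono (by linarith : T₁ < T₁ + 1)
    exact h1.trans_le (hle_c _)
  have hA : 0 < sqSumLT D.k (D.coord (θ (T₁, y))) := by
    have h := D.apply_eq_sub_add hz_src
    rw [hT₁B, add_zero] at h
    have h0 : 0 ≤ sqSumLT D.k (D.coord (θ (T₁, y))) := sqSumLT_nonneg _ _
    rcases h0.lt_or_eq with hpos | hzero
    · exact hpos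
    · rw [← hzero, sub_zero] at h; linarith
  have hfz_ge : f c - η ≤ f (θ (T₁, y)) := by
    rw [← hfy]
    have h := hmono.monotone (le_max_right T₀ 0)
    simp only [comp_apply, flow_zero] at h
    exact h
  -- backwards on the disc to the level
  obtain ⟨t, ht0, hstay, hft⟩ := D.exists_backward_level hflow hfc hη
    (show η + 0 < D.ε ^ 2 by rw [add_zero]; exact hηε) hz_src hA hfz_ge (le_of_eq hT₁B)
  -- the level point is `y`
  have hgrp2 : θ (t, θ (T₁, y)) = flow hζ y (t + T₁) := by rw [hflow.map_add]
  have htime : t + T₁ = 0 := by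
    apply hmono.injective
    show f (flow hζ y (t + T₁)) = f (flow hζ y 0)
    rw [flow_zero, hfy, ← hgrp2, hft]
  have hyz : θ (t, θ (T₁, y)) = y := by rw [hgrp2, htime, flow_zero]
  have hsrc : ∀ r ∈ Icc t 0, θ (r, θ (T₁, y)) ∈ D.chart.source := fun r hr => (hstay r hr).1
  have hBexp := hflow.sqSumGE_coord_eq_exp D ht0 hsrc
  rw [hflow.map_zero, hT₁B] at hBexp
  have hBy : sqSumGE D.k (D.coord (θ (t, θ (T₁, y)))) = 0 := by
    have hexp : Real.exp (2 * (0 - t)) ≠ 0 := (Real.exp_pos _).ne'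
    rcases mul_eq_zero.1 hBexp.symm with h | h
    · exact absurd h hexp
    · exact h
  have hy_src : y ∈ D.chart.source := by rw [← hyz]; exact (hstay t ⟨le_rfl, ht0⟩).1
  rw [hyz] at hBy
  refine ⟨hy_src, hBy, ?_⟩
  have h := D.apply_eq_sub_add hy_src
  rw [hBy, add_zero, hfy] at h
  linarith

/-- **The left-hand sphere lies in the stable set**: conversely, a point of the chart domain with
`y⃗ = 0` and `0 < |x⃗|² < ε_D²` is on a trajectory going to `c` (it is a point of the stable
disc of the box). [cite: MilnorHCobordism1965, proof of Thm. 3.12 and Thm. 3.13 (PDF pp. 18–19)] -/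
theorem MilnorBox.mem_stableSet_of_coord {f : X → ℝ}
    {ζ : Π x : X, TangentSpace (𝓡 4) x} {c : X}
    (hζ : ContMDiff (𝓡 4) (𝓡 4).tangent ∞ fun x => (⟨x, ζ x⟩ : TangentBundle (𝓡 4) X))
    (D : MilnorBox (𝓡 4) f ζ c) {y : X} (hy : y ∈ D.chart.source)
    (hB : sqSumGE D.k (D.coord y) = 0) (hA : sqSumLT D.k (D.coord y) < D.ε ^ 2) :
    y ∈ stableSet (𝓡 4) ζ c := by
  have hflow : IsFlowOf (𝓡 4) ζ (fun p : ℝ × X => flow hζ p.2 p.1) := (isSmoothFlow_flow hζ).isFlowOf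
  have hbox : y ∈ D.box := ⟨hy, hA, by rw [hB]; exact mul_pos (by norm_num) (pow_pos D.eps_pos 2)⟩
  rw [stableSet_eq_setOf_tendsto hζ]
  exact D.tendsto_atTop_of_sqSumGE_eq_zero hflow hbox hB

/-! ### The link condition for bi-collar data -/

namespace BiCollar

variable {B : BiCollar X}

/-- **The link condition from Milnor boxes** (Gay–Kirby's first hypothesis of Lemma 14, "the
attaching link of the `2`-handles lies in `int H₁₂`", in the form used by
`BiCollar.exists_isBalancedGKTrisection_of_handles`).  Let the unit field `U.ξ` of the bi-collar
data be a positive multiple `ρ • ζ` of a gradient-like field `ζ` of the Morse function `f`; let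
every critical point `q` with `a < f q ≤ c` be one of the centres `c_j` of Milnor boxes `D j` of
`(f, ζ)` reaching below the Heegaard level, `f c_j - a < ε_j²`; and let the Heegaard function
satisfy `g < b - η` at every point of the level lying in the chart domain of some `D j` with
`y⃗ = 0` (the attaching circles).  Then every point of the level on a trajectory of `U.ξ` going
to such a `q` has `g < b - η`. [cite: GayKirby2016, §4, Lemma 14 and proof of Thm. 4] [cite: MilnorHCobordism1965, Thm. 3.13 (PDF p. 19)] -/
theorem MorseFrame.linkCondition_of_milnorBoxes (Fr : B.MorseFrame)
    {ζ : Π x : X, TangentSpace (𝓡 4) x} {ρ : X → ℝ}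
    (hζ : ContMDiff (𝓡 4) (𝓡 4).tangent ∞ fun x => (⟨x, ζ x⟩ : TangentBundle (𝓡 4) X))
    (hgl : IsGradientLike (𝓡 4) B.f ζ) (hYeq : ∀ x, B.U.ξ x = ρ x • ζ x)
    (hρc : Continuous ρ) (hρ : ∀ x, 0 < ρ x)
    {ι : Type*} {cpt : ι → X} (D : ∀ j, MilnorBox (𝓡 4) B.f ζ (cpt j))
    (hlev : ∀ j, B.f (cpt j) - B.a < (D j).ε ^ 2) (hapos : ∀ j, B.a < B.f (cpt j))
    {c η : ℝ} (hcrit : ∀ q, IsMCriticalPt (𝓡 4) B.f q → B.a < B.f q → B.f q ≤ c → ∃ j, q = cpt j)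
    (hg : ∀ j (y : B.Y), RegularLevel.incl B.hf y ∈ (D j).chart.source →
      sqSumGE (D j).k ((D j).coord (RegularLevel.incl B.hf y)) = 0 →
      sqSumLT (D j).k ((D j).coord (RegularLevel.incl B.hf y)) = B.f (cpt j) - B.a →
      B.g y < B.b - η) :
    ∀ q : X, IsMCriticalPt (𝓡 4) B.f q → B.a < B.f q → B.f q ≤ c →
      ∀ y : B.Y, RegularLevel.incl B.hf y ∈ stableSet (𝓡 4) B.U.ξ q → B.g y < B.b - η := by
  intro q hq haq hqc y hy
  obtain ⟨j, rfl⟩ := hcrit q hq haq hqc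
  have hy' : RegularLevel.incl B.hf y ∈ stableSet (𝓡 4) ζ (cpt j) := by
    rw [← stableSet_smul_eq hζ B.U.contMDiff hYeq hρc hρ (cpt j)]
    exact hy
  have hη : 0 < B.f (cpt j) - B.a := sub_pos.2 (hapos j)
  have hfy : B.f (RegularLevel.incl B.hf y) = B.f (cpt j) - (B.f (cpt j) - B.a) := by
    rw [RegularLevel.apply_incl B.hf y]; ring
  obtain ⟨hsrc, hB, hA⟩ := (D j).coord_of_mem_stableSet_of_apply_eq hζ hgl Fr.isMorse hη (hlev j) hy' hfy
  exact hg j y hsrc hB hA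

end BiCollar

end Literature.Topology.FourManifolds

end
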